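import Summits.AtomisticToContinuum.HydrodynamicLimit.Theses.LambertianContactSwap
import Summits.AtomisticToContinuum.HydrodynamicLimit.Theorems.LambertianContactSwapContactAngleEquidistributionNearFieldTools
import Literature.Analysis.FluidPDE.HardSphereFlowMeasurable
import Literature.MathematicalPhysics.KineticTheory.HardSphereEulerProofs
import HarnessLib

/-!
# Stub `stub_nearField` of the line `Sketch` (skeleton v4, MIDPOINT-BALL criterion) of the crux `ContactAngleEquidistribution`
# (stmt-AtomisticToContinuum-12097, route LambertianContactSwap): REDUCTION of the near-field balance

Support file (`--supports`), lead `prover-line-stmt-AtomisticToContinuum-12097-c1-0`. This is the midpoint-ball variant of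
`…Theorems.LambertianContactSwapContactAngleEquidistributionNearField` (skeleton v1–v3, DUMBBELL criterion: a third centre within `2ε`
of one of the two colliders). In skeleton v4 of line `Sketch` the near-field selector of a pre-collisional contact configuration is
the MIDPOINT BALL: a third centre within `3ε` of the contact midpoint `x_mid = x_j + ½ sepVec(x_i, x_j)`. The point of the change:
in incoming midpoint/normal flux coordinates `(x_mid, ω, others, velocities)` the ball criterion does not depend on the normal `ω`,
so the ADMISSIBLE NORMALS of the actual environment (`admissibleNormalsBall`: directions `n` such that the pair re-placed at
`x_mid ± (ε/2) n`, all other spheres kept, overlaps no third sphere) carry no "still near-field" clause, and the isolated stratum is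
centred exactly under the homogeneous Gibbs law.

The registered stub `stub_nearField` (v4) is `NearFieldBalanceBall` below (verbatim, `@[conjecture]`): under the local Gibbs law the
near-field part of the capped, `|g|²`-weighted, `κ_g`-centred contact-angle collision sum has normalised expectation `→ 0`. It is NOT
proved here; it is PROVED from two cleanly separated open statements (`@[conjecture]`), the ball analogues of the dumbbell file's:

* `NearFieldAdmissibleCosineLawBall` — every admissible environment-blind mark is centred, in near-field collision average, by the
  cosine law CONDITIONED ON THE ADMISSIBLE NORMALS of the actual pre-collisional environment. Exact in equilibrium at every `N` by
  the stationary special-flow / Campbell identity (CIP 1994 App. 4.A; tree `HardSphereCampbellFormula`): the pre-collisional contact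
  flux is `1_D (g·ω)₋ dω d(rest)` and on each `ω`-fibre `1_D · [near]` is `[near] ·` (indicator of the admissible normals), `[near]`
  being `ω`-free; out of equilibrium a pre-collisional chaos statement at the contact scale including the blocking environment.
* `NearFieldBlockingIsotropyBall` — the admissible-conditioned cosine mean and the full cosine mean of the mark agree in near-field
  collision average given `(s, x_mid, v, v_*)` (isotropy of the `1/κ_g(Adm)`-reweighted blocking geometry; shear-induced defect
  `∝ Kn`, Lutsko 1996).

`stub_nearFieldReductionBall : NearFieldAdmissibleCosineLawBall → NearFieldBlockingIsotropyBall → NearFieldBalanceBall` (registered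
sub-goal of wave 3) is the bookkeeping, verbatim the dumbbell file's: the two summands add up pointwise to the stub's
(`(ψ − κ^{adm}ψ) + (κ^{adm}ψ − κψ) = ψ − κψ`), and both marked collision sums are integrable for every `N` — measurable over
Alexander's construction (tools file `…NearFieldTools`: `NearField.measurable_*`, plus the ball selectors `NearField.measurableSet_nearBall`,
`NearField.measurable_admissibleCosineMeanBall` of this file) and dominated by twice the `|g|³`-weighted collision count, whose local
Gibbs expectation is finite for each `N` (`stub_nearFieldFinite`). WIRING for the lead skeleton: two new stubs
`h₁ : NearFieldAdmissibleCosineLawBall`, `h₂ : NearFieldBlockingIsotropyBall`, and `theorem stub_nearField : <registered signature> :=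
stub_nearFieldReductionBall h₁ h₂`.

References: J. F. Lutsko, Phys. Rev. Lett. 77 (1996) 2225; C. Cercignani, R. Illner, M. Pulvirenti, *The Mathematical Theory of
Dilute Gases* (1994) §2.2, App. 4.A; I. Gallagher, L. Saint-Raymond, B. Texier, *From Newton to Boltzmann* (2013) Ch. 4.
-/

noncomputable section

open MeasureTheory Filter Set Topology ProbabilityTheory
open scoped ENNReal BigOperators Classical

namespace Summit.AtomisticToContinuum.HydrodynamicLimit.Theorems.ContactAngleEquidistributionSketch

open Literature.Analysis.FluidPDE Literature.MathematicalPhysics.KineticTheory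
open Summit.AtomisticToContinuum.HydrodynamicLimit.Theses.LambertianContactSwap

/-! ## The admissible normals for the midpoint-ball criterion -/

/-- The ADMISSIBLE NORMALS of the pair `(i, j)` of `y` about the midpoint `x` at diameter `ε`, MIDPOINT-BALL criterion: candidates
`n` such that re-placing `i` at `x + (ε/2) n` and `j` at `x − (ε/2) n` (other spheres kept) overlaps no third sphere
(= `admissibleNormals` without its "still near-field" conjunct, which for the ball criterion does not depend on `n`).
[cite: CIP1994, App. 4.A pp. 108–111] -/
def admissibleNormalsBall (ε : ℝ) {n : ℕ} (y : Config n (Fin 3) T3) (i j : Fin n) (x : T3) : Set V3 :=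
  {ν | ∀ k : Fin n, k ≠ i → k ≠ j →
      ε ≤ ‖(Torus.geometry (Fin 3)).sepVec (y k).1 ((Torus.geometry (Fin 3)).translate x ((ε / 2) • ν))‖ ∧
      ε ≤ ‖(Torus.geometry (Fin 3)).sepVec (y k).1 ((Torus.geometry (Fin 3)).translate x (-((ε / 2) • ν)))‖}

/-! ## The three statements (the crux's own `let` dialect; `NearFieldBalanceBall` is verbatim the registered stub, skeleton v4) -/

/-- `NearFieldBalanceBall` — VERBATIM the registered stub `stub_nearField` of line `Sketch`, skeleton v4 (crux
ContactAngleEquidistribution, stmt-AtomisticToContinuum-12097): under the local Gibbs law the NEAR-FIELD part (a third centre within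
`3ε` of the contact midpoint) of the capped, `κ_g`-centred, `|g|²`-weighted contact-angle collision sum has normalised expectation
tending to `0`. OPEN (the crux's kernel, card `last-flight-cap-pullback`); reduced below (`stub_nearFieldReductionBall`) to
`NearFieldAdmissibleCosineLawBall ∧ NearFieldBlockingIsotropyBall`. [cite: Lutsko1996, PRL 77 p. 2225] -/
@[conjecture] def NearFieldBalanceBall : Prop :=
    let Cfg : ℕ → Type := fun N => Config (N + 1) (Fin 3) T3
    let G := Torus.geometry (Fin 3)
    let ε : ℝ → ℕ → ℝ := hsDiameter
    let τ : ℝ → (N : ℕ) → Cfg N → ℝ≥0∞ := fun σ N z => Alexander.freeExitTime G (ε σ N) z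
    let S : ℝ → (N : ℕ) → Cfg N → Cfg N := fun t _ z => freeFlight G t z
    let ldir : V3 → V3 → V3 := fun ω ξ => ‖‖ω‖⁻¹ • ω + ‖ξ‖⁻¹ • ξ‖⁻¹ • (‖ω‖⁻¹ • ω + ‖ξ‖⁻¹ • ξ)
    let zpre : ℝ → (N : ℕ) → Cfg N → ℕ → Cfg N := fun σ N z m =>
      let y := Alexander.stateAfter G (ε σ N) z m; S (τ σ N y).toReal N y
    let Kt : ℝ → (N : ℕ) → Cfg N → ℝ → ℕ := fun σ N z t => Alexander.collisionCount G (ε σ N) z t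
    let hit : ℝ → (N : ℕ) → Cfg N → Fin (N + 1) → Fin (N + 1) → Prop := fun σ N y i j =>
      i < j ∧ y ∈ contactSet G (N + 1) (ε σ N) i j ∧ IsIncoming G y i j
    let tcol : ℝ → (N : ℕ) → Cfg N → ℕ → ℝ := fun σ N z m =>
      (Alexander.collisionInstant G (ε σ N) z (m + 1)).toReal
    let xmid : (N : ℕ) → Cfg N → Fin (N + 1) → Fin (N + 1) → T3 := fun _ y i j =>
      G.translate (y j).1 ((2 : ℝ)⁻¹ • G.sepVec (y i).1 (y j).1)
    let near : ℝ → (N : ℕ) → Cfg N → Fin (N + 1) → Fin (N + 1) → Prop := fun σ N y i j =>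
      ∃ k : Fin (N + 1), k ≠ i ∧ k ≠ j ∧ ‖G.sepVec (y k).1 (xmid N y i j)‖ ≤ 3 * ε σ N
    ∀ (a₀ θ₀ : T3 → ℝ) (u₀ : T3 → V3), Continuous a₀ → Continuous θ₀ → Continuous u₀ →
      (∀ x, 0 < a₀ x) → (∀ x, 0 < θ₀ x) →
      ∃ σ₀ : ℝ, 0 < σ₀ ∧ ∀ σ : ℝ, 0 < σ → σ < σ₀ →
      ∀ Φ : (N : ℕ) → HardSphereFlow G (ε σ N) (N + 1),
      let P := fun N => localGibbsLaw σ a₀ u₀ θ₀ N (Φ N)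
      ∀ t : ℝ, 0 ≤ t → ∀ V : ℝ, 0 < V →
      ∀ ψ : ℕ → ℝ → T3 → V3 → V3 → V3 → ℝ,
        (∀ N, Measurable (fun p : ℝ × T3 × V3 × V3 × V3 =>
          ψ N p.1 p.2.1 p.2.2.1 p.2.2.2.1 p.2.2.2.2)) →
        (∀ N s x v w n, |ψ N s x v w n| ≤ 1) →
        (∀ N s x v w (n n' : V3), ‖n‖ = 1 → ‖n'‖ = 1 →
          |ψ N s x v w n - ψ N s x v w n'| ≤ ‖n - n'‖) →
        Tendsto (fun N : ℕ => ∫ z, ((N : ℝ) + 1) ^ (-(4 / 3 : ℝ)) *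
          ∑ m ∈ Finset.range (Kt σ N z t), ∑ i : Fin (N + 1), ∑ j : Fin (N + 1),
            (let y := zpre σ N z m
             if hit σ N y i j then
               (if near σ N y i j then
                 (if V < ‖(y i).2 - (y j).2‖ then 0 else
                   ‖(y i).2 - (y j).2‖ ^ 2 *
                     (ψ N (tcol σ N z m) (xmid N y i j) (y i).2 (y j).2
                         ((ε σ N)⁻¹ • G.sepVec (y i).1 (y j).1) -
                       ∫ ξ, ψ N (tcol σ N z m) (xmid N y i j) (y i).2 (y j).2
                         (ldir (-((y i).2 - (y j).2)) ξ) ∂(stdGaussian V3)))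
                else 0)
             else 0) ∂(P N)) atTop (𝓝 0)

/-- `NearFieldAdmissibleCosineLawBall` (OPEN; the dynamical half of the near-field balance, midpoint-ball criterion): in near-field,
speed-capped, `|g|²`-weighted collision average under the local Gibbs law, every admissible environment-blind mark
`ψ_N(s, x_mid, v, v_*, ω)` is centred by the cosine law conditioned on the admissible normals of the actual pre-collisional environment
(`admissibleCosineMean (admissibleNormalsBall …)`). Exact in equilibrium at every `N` by the special-flow (Campbell) identity: the
contact flux is `1_D (g·ω)₋ dω d(rest)`, `1_D` restricted to an `ω`-fibre is the indicator of the admissible normals and the ball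
selector `[near]` is `ω`-free; in general a pre-collisional chaos statement at the contact scale including the blocking environment.
[cite: CIP1994, App. 4.A pp. 107–111] -/
@[conjecture] def NearFieldAdmissibleCosineLawBall : Prop :=
    let Cfg : ℕ → Type := fun N => Config (N + 1) (Fin 3) T3; let G := Torus.geometry (Fin 3); let ε : ℝ → ℕ → ℝ := hsDiameter
    let τ : ℝ → (N : ℕ) → Cfg N → ℝ≥0∞ := fun σ N z => Alexander.freeExitTime G (ε σ N) z
    let S : ℝ → (N : ℕ) → Cfg N → Cfg N := fun t _ z => freeFlight G t z
    let zpre : ℝ → (N : ℕ) → Cfg N → ℕ → Cfg N := fun σ N z m => let y := Alexander.stateAfter G (ε σ N) z m; S (τ σ N y).toReal N y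
    let Kt : ℝ → (N : ℕ) → Cfg N → ℝ → ℕ := fun σ N z t => Alexander.collisionCount G (ε σ N) z t
    let hit : ℝ → (N : ℕ) → Cfg N → Fin (N + 1) → Fin (N + 1) → Prop := fun σ N y i j =>
      i < j ∧ y ∈ contactSet G (N + 1) (ε σ N) i j ∧ IsIncoming G y i j
    let tcol : ℝ → (N : ℕ) → Cfg N → ℕ → ℝ := fun σ N z m => (Alexander.collisionInstant G (ε σ N) z (m + 1)).toReal
    let xmid : (N : ℕ) → Cfg N → Fin (N + 1) → Fin (N + 1) → T3 := fun _ y i j => G.translate (y j).1 ((2 : ℝ)⁻¹ • G.sepVec (y i).1 (y j).1)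
    let near : ℝ → (N : ℕ) → Cfg N → Fin (N + 1) → Fin (N + 1) → Prop := fun σ N y i j =>
      ∃ k : Fin (N + 1), k ≠ i ∧ k ≠ j ∧ ‖G.sepVec (y k).1 (xmid N y i j)‖ ≤ 3 * ε σ N
    let adm : ℝ → (N : ℕ) → Cfg N → Fin (N + 1) → Fin (N + 1) → Set V3 := fun σ N y i j => admissibleNormalsBall (ε σ N) y i j (xmid N y i j)
    ∀ (a₀ θ₀ : T3 → ℝ) (u₀ : T3 → V3), Continuous a₀ → Continuous θ₀ → Continuous u₀ → (∀ x, 0 < a₀ x) → (∀ x, 0 < θ₀ x) →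
      ∃ σ₀ : ℝ, 0 < σ₀ ∧ ∀ σ : ℝ, 0 < σ → σ < σ₀ → ∀ Φ : (N : ℕ) → HardSphereFlow G (ε σ N) (N + 1),
      let P := fun N => localGibbsLaw σ a₀ u₀ θ₀ N (Φ N)
      ∀ t : ℝ, 0 ≤ t → ∀ V : ℝ, 0 < V → ∀ ψ : ℕ → ℝ → T3 → V3 → V3 → V3 → ℝ,
        (∀ N, Measurable (fun p : ℝ × T3 × V3 × V3 × V3 => ψ N p.1 p.2.1 p.2.2.1 p.2.2.2.1 p.2.2.2.2)) →
        (∀ N s x v w n, |ψ N s x v w n| ≤ 1) →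
        (∀ N s x v w (n n' : V3), ‖n‖ = 1 → ‖n'‖ = 1 → |ψ N s x v w n - ψ N s x v w n'| ≤ ‖n - n'‖) →
        Tendsto (fun N : ℕ => ∫ z, ((N : ℝ) + 1) ^ (-(4 / 3 : ℝ)) *
          ∑ m ∈ Finset.range (Kt σ N z t), ∑ i : Fin (N + 1), ∑ j : Fin (N + 1),
            (let y := zpre σ N z m
             if hit σ N y i j then
               (if near σ N y i j then
                 (if V < ‖(y i).2 - (y j).2‖ then 0 else
                   ‖(y i).2 - (y j).2‖ ^ 2 *
                     (ψ N (tcol σ N z m) (xmid N y i j) (y i).2 (y j).2 ((ε σ N)⁻¹ • G.sepVec (y i).1 (y j).1) -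
                       admissibleCosineMean (adm σ N y i j) ((y i).2 - (y j).2) (ψ N (tcol σ N z m) (xmid N y i j) (y i).2 (y j).2)))
                else 0)
             else 0) ∂(P N)) atTop (𝓝 0)

/-- `NearFieldBlockingIsotropyBall` (OPEN; the structural half of the near-field balance, midpoint-ball criterion): in near-field,
speed-capped, `|g|²`-weighted collision average under the local Gibbs law, the admissible-conditioned cosine mean of every admissible
environment-blind mark agrees with its full cosine mean `κ_g ψ` — the law of the admissible set of normals of near-field collisions
given `(s, x_mid, v, v_*)`, reweighted by `1/κ_g(admissible set)`, is isotropic on the incoming hemisphere. In equilibrium: rotation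
invariance about `x_mid` of the positional Gibbs weight of the environments with a third centre in the midpoint ball (exact in
infinite volume); in general: isotropy, given the pair velocities, of the pre-collisional near-field cluster shape, whose shear-induced
defect is `∝ Kn`. [cite: Lutsko1996, PRL 77 p. 2225] -/
@[conjecture] def NearFieldBlockingIsotropyBall : Prop :=
    let Cfg : ℕ → Type := fun N => Config (N + 1) (Fin 3) T3; let G := Torus.geometry (Fin 3); let ε : ℝ → ℕ → ℝ := hsDiameter
    let τ : ℝ → (N : ℕ) → Cfg N → ℝ≥0∞ := fun σ N z => Alexander.freeExitTime G (ε σ N) z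
    let S : ℝ → (N : ℕ) → Cfg N → Cfg N := fun t _ z => freeFlight G t z
    let ldir : V3 → V3 → V3 := fun ω ξ => ‖‖ω‖⁻¹ • ω + ‖ξ‖⁻¹ • ξ‖⁻¹ • (‖ω‖⁻¹ • ω + ‖ξ‖⁻¹ • ξ)
    let zpre : ℝ → (N : ℕ) → Cfg N → ℕ → Cfg N := fun σ N z m => let y := Alexander.stateAfter G (ε σ N) z m; S (τ σ N y).toReal N y
    let Kt : ℝ → (N : ℕ) → Cfg N → ℝ → ℕ := fun σ N z t => Alexander.collisionCount G (ε σ N) z t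
    let hit : ℝ → (N : ℕ) → Cfg N → Fin (N + 1) → Fin (N + 1) → Prop := fun σ N y i j =>
      i < j ∧ y ∈ contactSet G (N + 1) (ε σ N) i j ∧ IsIncoming G y i j
    let tcol : ℝ → (N : ℕ) → Cfg N → ℕ → ℝ := fun σ N z m => (Alexander.collisionInstant G (ε σ N) z (m + 1)).toReal
    let xmid : (N : ℕ) → Cfg N → Fin (N + 1) → Fin (N + 1) → T3 := fun _ y i j => G.translate (y j).1 ((2 : ℝ)⁻¹ • G.sepVec (y i).1 (y j).1)
    let near : ℝ → (N : ℕ) → Cfg N → Fin (N + 1) → Fin (N + 1) → Prop := fun σ N y i j =>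
      ∃ k : Fin (N + 1), k ≠ i ∧ k ≠ j ∧ ‖G.sepVec (y k).1 (xmid N y i j)‖ ≤ 3 * ε σ N
    let adm : ℝ → (N : ℕ) → Cfg N → Fin (N + 1) → Fin (N + 1) → Set V3 := fun σ N y i j => admissibleNormalsBall (ε σ N) y i j (xmid N y i j)
    ∀ (a₀ θ₀ : T3 → ℝ) (u₀ : T3 → V3), Continuous a₀ → Continuous θ₀ → Continuous u₀ → (∀ x, 0 < a₀ x) → (∀ x, 0 < θ₀ x) →
      ∃ σ₀ : ℝ, 0 < σ₀ ∧ ∀ σ : ℝ, 0 < σ → σ < σ₀ → ∀ Φ : (N : ℕ) → HardSphereFlow G (ε σ N) (N + 1),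
      let P := fun N => localGibbsLaw σ a₀ u₀ θ₀ N (Φ N)
      ∀ t : ℝ, 0 ≤ t → ∀ V : ℝ, 0 < V → ∀ ψ : ℕ → ℝ → T3 → V3 → V3 → V3 → ℝ,
        (∀ N, Measurable (fun p : ℝ × T3 × V3 × V3 × V3 => ψ N p.1 p.2.1 p.2.2.1 p.2.2.2.1 p.2.2.2.2)) →
        (∀ N s x v w n, |ψ N s x v w n| ≤ 1) →
        (∀ N s x v w (n n' : V3), ‖n‖ = 1 → ‖n'‖ = 1 → |ψ N s x v w n - ψ N s x v w n'| ≤ ‖n - n'‖) →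
        Tendsto (fun N : ℕ => ∫ z, ((N : ℝ) + 1) ^ (-(4 / 3 : ℝ)) *
          ∑ m ∈ Finset.range (Kt σ N z t), ∑ i : Fin (N + 1), ∑ j : Fin (N + 1),
            (let y := zpre σ N z m
             if hit σ N y i j then
               (if near σ N y i j then
                 (if V < ‖(y i).2 - (y j).2‖ then 0 else
                   ‖(y i).2 - (y j).2‖ ^ 2 *
                     (admissibleCosineMean (adm σ N y i j) ((y i).2 - (y j).2) (ψ N (tcol σ N z m) (xmid N y i j) (y i).2 (y j).2) -
                       ∫ ξ, ψ N (tcol σ N z m) (xmid N y i j) (y i).2 (y j).2 (ldir (-((y i).2 - (y j).2)) ξ) ∂(stdGaussian V3)))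
                else 0)
             else 0) ∂(P N)) atTop (𝓝 0)

/-! ## Tools for the ball selectors: measurability -/

namespace NearField

/-- The midpoint-ball `near` selector (a third centre within `3ε` of the contact midpoint) is a measurable condition of a measurably
varying configuration. [folklore] -/
theorem measurableSet_nearBall {α : Type*} [MeasurableSpace α] (ε : ℝ) {n : ℕ} {y : α → Config n (Fin 3) T3} (hy : Measurable y)
    (i j : Fin n) :
    MeasurableSet {a | ∃ k : Fin n, k ≠ i ∧ k ≠ j ∧ ‖(Torus.geometry (Fin 3)).sepVec (y a k).1
      ((Torus.geometry (Fin 3)).translate (y a j).1 ((2 : ℝ)⁻¹ • (Torus.geometry (Fin 3)).sepVec (y a i).1 (y a j).1))‖ ≤ 3 * ε} := by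
  have hGm := Torus.isMeasurable_geometry (d := Fin 3)
  have hxm := measurable_xmid' hy i j
  have hs : ∀ k : Fin n, Measurable fun a => ‖(Torus.geometry (Fin 3)).sepVec (y a k).1
      ((Torus.geometry (Fin 3)).translate (y a j).1 ((2 : ℝ)⁻¹ • (Torus.geometry (Fin 3)).sepVec (y a i).1 (y a j).1))‖ :=
    fun k => (hGm.measurable_sepVec.comp (((Geometry.IsMeasurable.measurable_pos k).comp hy).prodMk hxm)).norm
  exact measurableSet_setOf.2 (Measurable.exists fun k => measurable_const.and (measurable_const.and ((hs k).le' measurable_const)))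

/-- Membership of a measurably varying vector in the ball-criterion admissible normals of a measurably varying configuration is a
measurable condition. [folklore]
-- adapted from `NearField.measurableSet_mem_admissibleNormals` (tools file), dropping the near-field conjunct -/
theorem measurableSet_mem_admissibleNormalsBall {α : Type*} [MeasurableSpace α] (ε : ℝ) {n : ℕ} {y : α → Config n (Fin 3) T3}
    (hy : Measurable y) (i j : Fin n) {x : α → T3} (hx : Measurable x) {ν : α → V3} (hν : Measurable ν) :
    MeasurableSet {a | ν a ∈ admissibleNormalsBall ε (y a) i j (x a)} := by
  have hGm := Torus.isMeasurable_geometry (d := Fin 3)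
  have hpos : ∀ k : Fin n, Measurable fun a => (y a k).1 := fun k => (Geometry.IsMeasurable.measurable_pos k).comp hy
  have hsm : Measurable fun a => (ε / 2) • ν a := hν.const_smul (ε / 2)
  have hp : Measurable fun a => (Torus.geometry (Fin 3)).translate (x a) ((ε / 2) • ν a) :=
    hGm.measurable_translate.comp (hx.prodMk hsm)
  have hm : Measurable fun a => (Torus.geometry (Fin 3)).translate (x a) (-((ε / 2) • ν a)) :=
    hGm.measurable_translate.comp (hx.prodMk hsm.neg)
  have h1 : ∀ k : Fin n, Measurable fun a =>
      ‖(Torus.geometry (Fin 3)).sepVec (y a k).1 ((Torus.geometry (Fin 3)).translate (x a) ((ε / 2) • ν a))‖ :=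
    fun k => (hGm.measurable_sepVec.comp ((hpos k).prodMk hp)).norm
  have h2 : ∀ k : Fin n, Measurable fun a =>
      ‖(Torus.geometry (Fin 3)).sepVec (y a k).1 ((Torus.geometry (Fin 3)).translate (x a) (-((ε / 2) • ν a)))‖ :=
    fun k => (hGm.measurable_sepVec.comp ((hpos k).prodMk hm)).norm
  have hP1 : ∀ k : Fin n, Measurable fun a => k ≠ i → k ≠ j →
      ε ≤ ‖(Torus.geometry (Fin 3)).sepVec (y a k).1 ((Torus.geometry (Fin 3)).translate (x a) ((ε / 2) • ν a))‖ ∧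
      ε ≤ ‖(Torus.geometry (Fin 3)).sepVec (y a k).1 ((Torus.geometry (Fin 3)).translate (x a) (-((ε / 2) • ν a)))‖ :=
    fun k => measurable_const.imp (measurable_const.imp ((measurable_const.le' (h1 k)).and (measurable_const.le' (h2 k))))
  exact measurableSet_setOf.2 (Measurable.forall hP1)

/-- Measurability of `a ↦ admissibleCosineMean (admissibleNormalsBall ε (y a) i j (x a)) (g a) (φ a)` for measurable data. [folklore]
-- adapted from `NearField.measurable_admissibleCosineMean` (tools file) -/
theorem measurable_admissibleCosineMeanBall {α : Type*} [MeasurableSpace α] (ε : ℝ) {n : ℕ} {y : α → Config n (Fin 3) T3}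
    (hy : Measurable y) (i j : Fin n) {x : α → T3} (hx : Measurable x) {g : α → V3} (hg : Measurable g) {φ : α → V3 → ℝ}
    (hφ : Measurable fun q : α × V3 => φ q.1 q.2) :
    Measurable fun a => admissibleCosineMean (admissibleNormalsBall ε (y a) i j (x a)) (g a) (φ a) := by
  unfold admissibleCosineMean
  have hL := measurable_ldir_neg hg
  have hy' : Measurable fun q : α × V3 => y q.1 := hy.comp measurable_fst
  have hx' : Measurable fun q : α × V3 => x q.1 := hx.comp measurable_fst
  have hA := measurableSet_mem_admissibleNormalsBall ε hy' i j hx' hL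
  have hφL : Measurable fun q : α × V3 =>
      φ q.1 (‖‖-g q.1‖⁻¹ • (-g q.1) + ‖q.2‖⁻¹ • q.2‖⁻¹ • (‖-g q.1‖⁻¹ • (-g q.1) + ‖q.2‖⁻¹ • q.2)) := hφ.comp (measurable_fst.prodMk hL)
  have hnum : Measurable fun q : α × V3 =>
      if ‖‖-g q.1‖⁻¹ • (-g q.1) + ‖q.2‖⁻¹ • q.2‖⁻¹ • (‖-g q.1‖⁻¹ • (-g q.1) + ‖q.2‖⁻¹ • q.2) ∈ admissibleNormalsBall ε (y q.1) i j (x q.1)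
      then φ q.1 (‖‖-g q.1‖⁻¹ • (-g q.1) + ‖q.2‖⁻¹ • q.2‖⁻¹ • (‖-g q.1‖⁻¹ • (-g q.1) + ‖q.2‖⁻¹ • q.2)) else 0 :=
    Measurable.ite hA hφL measurable_const
  have hden : Measurable fun q : α × V3 =>
      if ‖‖-g q.1‖⁻¹ • (-g q.1) + ‖q.2‖⁻¹ • q.2‖⁻¹ • (‖-g q.1‖⁻¹ • (-g q.1) + ‖q.2‖⁻¹ • q.2) ∈ admissibleNormalsBall ε (y q.1) i j (x q.1)
      then (1 : ℝ) else 0 := Measurable.ite hA measurable_const measurable_const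
  exact (hnum.stronglyMeasurable.integral_prod_right' (ν := stdGaussian V3)).measurable.fun_div
    (hden.stronglyMeasurable.integral_prod_right' (ν := stdGaussian V3)).measurable

end NearField

/-! ## The reduction -/

/-- **The near-field balance (midpoint-ball criterion) follows from the admissible-cosine law and blocking isotropy.** The two
centred summands add up pointwise to the stub's (`(ψ − κ^{adm}ψ) + (κ^{adm}ψ − κψ) = ψ − κψ`), and each marked collision sum is
integrable under the local Gibbs law for every `N` (measurable over Alexander's construction; dominated by twice the `|g|³`-weighted
collision count, whose expectation is finite for each `N`), so the expectations add and the two limits sum. [folklore]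
-- adapted from `stub_nearFieldReduction` (dumbbell criterion, `…Theorems.LambertianContactSwapContactAngleEquidistributionNearField`) -/
theorem stub_nearFieldReductionBall : NearFieldAdmissibleCosineLawBall → NearFieldBlockingIsotropyBall → NearFieldBalanceBall := by
  intro H₁ H₂
  unfold NearFieldAdmissibleCosineLawBall at H₁
  unfold NearFieldBlockingIsotropyBall at H₂
  unfold NearFieldBalanceBall
  dsimp (config := { zeta := true }) only
  dsimp (config := { zeta := true }) only at H₁
  dsimp (config := { zeta := true }) only at H₂
  intro a₀ θ₀ u₀ ha hθ hu ha0 hθ0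
  obtain ⟨σ₁, hσ₁, H₁⟩ := H₁ a₀ θ₀ u₀ ha hθ hu ha0 hθ0
  obtain ⟨σ₂, hσ₂, H₂⟩ := H₂ a₀ θ₀ u₀ ha hθ hu ha0 hθ0
  have H₃ := stub_nearFieldFinite
  dsimp (config := { zeta := true }) only at H₃
  obtain ⟨σ₃, hσ₃, H₃⟩ := H₃ a₀ θ₀ u₀ ha hθ hu ha0 hθ0
  refine ⟨min (min σ₁ σ₂) (min σ₃ 2⁻¹), lt_min (lt_min hσ₁ hσ₂) (lt_min hσ₃ (by norm_num)), fun σ hσ hσlt Φ t ht V hV ψ hψm hψb hψl => ?_⟩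
  have hσ12 : σ < min σ₁ σ₂ := hσlt.trans_le (min_le_left _ _)
  have hσ2 : σ < 2⁻¹ := (hσlt.trans_le (min_le_right _ _)).trans_le (min_le_right _ _)
  have T₁ := H₁ σ hσ (hσ12.trans_le (min_le_left _ _)) Φ t ht V hV ψ hψm hψb hψl
  have T₂ := H₂ σ hσ (hσ12.trans_le (min_le_right _ _)) Φ t ht V hV ψ hψm hψb hψl
  have hW := H₃ σ hσ ((hσlt.trans_le (min_le_right _ _)).trans_le (min_le_left _ _)) Φ t ht
  have hK := fun N => NearField.measurable_Kt hσ hσ2 N t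
  have hpre := fun N m => NearField.measurable_zpre hσ hσ2 N m
  have htc := fun N m => NearField.measurable_tcol hσ hσ2 N m
  have hκ : ∀ N s x v w (g : V3), |∫ ξ, ψ N s x v w (‖‖-g‖⁻¹ • (-g) + ‖ξ‖⁻¹ • ξ‖⁻¹ • (‖-g‖⁻¹ • (-g) + ‖ξ‖⁻¹ • ξ)) ∂(stdGaussian V3)| ≤ 1 :=
    fun N s x v w g => NearField.abs_integral_le_one _ fun ξ => hψb N s x v w _
  -- measurability of the weight `(N+1)^{-4/3} Σ [hit] (1 + |g|³)` (its statement is read off `hW N` at each use)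
  have hWm : ∀ N m (i j : Fin (N + 1)), Measurable fun z : Config (N + 1) (Fin 3) T3 =>
      1 + ‖((freeFlight (Torus.geometry (Fin 3)) (Alexander.freeExitTime (Torus.geometry (Fin 3)) (hsDiameter σ N)
        (Alexander.stateAfter (Torus.geometry (Fin 3)) (hsDiameter σ N) z m)).toReal (Alexander.stateAfter (Torus.geometry (Fin 3)) (hsDiameter σ N) z m)) i).2 -
        ((freeFlight (Torus.geometry (Fin 3)) (Alexander.freeExitTime (Torus.geometry (Fin 3)) (hsDiameter σ N)
        (Alexander.stateAfter (Torus.geometry (Fin 3)) (hsDiameter σ N) z m)).toReal (Alexander.stateAfter (Torus.geometry (Fin 3)) (hsDiameter σ N) z m)) j).2‖ ^ 3 :=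
    fun N m i j => measurable_const.fun_add (((NearField.measurable_vel' (hpre N m) i).fun_sub (NearField.measurable_vel' (hpre N m) j)).norm.pow_const 3)
  refine NearField.tendsto_integral_of_eq_add _ T₁ T₂ ?_ ?_ ?_
  · intro N
    refine NearField.integrable_of_abs_le (hW N) ?_ ?_ fun z => ?_
    · refine (NearField.measurable_sum_range (hK N) fun m => Finset.measurable_sum _ fun i _ => Finset.measurable_sum _ fun j _ => ?_).const_mul _
      refine Measurable.ite (NearField.measurableSet_hit _ (hpre N m) i j) ?_ measurable_const
      refine Measurable.ite (NearField.measurableSet_nearBall _ (hpre N m) i j) ?_ measurable_const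
      have hg := (NearField.measurable_vel' (hpre N m) i).fun_sub (NearField.measurable_vel' (hpre N m) j)
      have hxm := NearField.measurable_xmid' (hpre N m) i j
      refine Measurable.ite (measurableSet_lt measurable_const hg.norm) measurable_const ((hg.norm.pow_const 2).fun_mul ?_)
      exact (NearField.measurable_psiAt (hψm N) (htc N m) hxm (NearField.measurable_vel' (hpre N m) i) (NearField.measurable_vel' (hpre N m) j)
        ((measurable_const (a := (hsDiameter σ N)⁻¹)).fun_smul (NearField.measurable_sepVec' (hpre N m) i j))).fun_sub
        (NearField.measurable_admissibleCosineMeanBall (hsDiameter σ N) (hpre N m) i j hxm hg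
          (NearField.measurable_psiAt (hψm N) ((htc N m).comp measurable_fst) (hxm.comp measurable_fst)
            ((NearField.measurable_vel' (hpre N m) i).comp measurable_fst) ((NearField.measurable_vel' (hpre N m) j).comp measurable_fst) measurable_snd))
    · refine (NearField.measurable_sum_range (hK N) fun m => Finset.measurable_sum _ fun i _ => Finset.measurable_sum _ fun j _ => ?_).const_mul _
      exact Measurable.ite (NearField.measurableSet_hit _ (hpre N m) i j) (hWm N m i j) measurable_const
    · refine NearField.abs_mul_sum3_le_two_mul _ _ (by positivity) _ _ fun m i j => ?_
      split_ifs
      · rw [abs_zero]; positivity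
      · exact NearField.abs_sq_mul_sub_le (norm_nonneg _) (hψb ..) (NearField.abs_admissibleCosineMean_le_one _ _ fun n => hψb ..)
      · rw [abs_zero]; positivity
      · simp
  · intro N
    refine NearField.integrable_of_abs_le (hW N) ?_ ?_ fun z => ?_
    · refine (NearField.measurable_sum_range (hK N) fun m => Finset.measurable_sum _ fun i _ => Finset.measurable_sum _ fun j _ => ?_).const_mul _
      refine Measurable.ite (NearField.measurableSet_hit _ (hpre N m) i j) ?_ measurable_const
      refine Measurable.ite (NearField.measurableSet_nearBall _ (hpre N m) i j) ?_ measurable_const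
      have hg := (NearField.measurable_vel' (hpre N m) i).fun_sub (NearField.measurable_vel' (hpre N m) j)
      have hxm := NearField.measurable_xmid' (hpre N m) i j
      refine Measurable.ite (measurableSet_lt measurable_const hg.norm) measurable_const ((hg.norm.pow_const 2).fun_mul ?_)
      exact (NearField.measurable_admissibleCosineMeanBall (hsDiameter σ N) (hpre N m) i j hxm hg
          (NearField.measurable_psiAt (hψm N) ((htc N m).comp measurable_fst) (hxm.comp measurable_fst)
            ((NearField.measurable_vel' (hpre N m) i).comp measurable_fst) ((NearField.measurable_vel' (hpre N m) j).comp measurable_fst) measurable_snd)).fun_sub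
        (NearField.measurable_cosineMean (hψm N) (htc N m) hxm (NearField.measurable_vel' (hpre N m) i) (NearField.measurable_vel' (hpre N m) j) hg)
    · refine (NearField.measurable_sum_range (hK N) fun m => Finset.measurable_sum _ fun i _ => Finset.measurable_sum _ fun j _ => ?_).const_mul _
      exact Measurable.ite (NearField.measurableSet_hit _ (hpre N m) i j) (hWm N m i j) measurable_const
    · refine NearField.abs_mul_sum3_le_two_mul _ _ (by positivity) _ _ fun m i j => ?_
      split_ifs
      · rw [abs_zero]; positivity
      · exact NearField.abs_sq_mul_sub_le (norm_nonneg _) (NearField.abs_admissibleCosineMean_le_one _ _ fun n => hψb ..) (hκ ..)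
      · rw [abs_zero]; positivity
      · simp
  · intro N z
    rw [← mul_add, ← Finset.sum_add_distrib]
    refine congrArg _ (Finset.sum_congr rfl fun m _ => ?_)
    rw [← Finset.sum_add_distrib]
    refine Finset.sum_congr rfl fun i _ => ?_
    rw [← Finset.sum_add_distrib]
    refine Finset.sum_congr rfl fun j _ => ?_
    split_ifs <;> ring

end Summit.AtomisticToContinuum.HydrodynamicLimit.Theorems.ContactAngleEquidistributionSketch

end
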